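import Literature.Computability.Complexity.BallGates
import Literature.Computability.MetaComplexity.RazborovSmolenskyBall
import HarnessLib

/-!
# Razborov–Smolensky for `G(k)` gates, II: circuit semantics and the approximation lemma

Second part of the **Razborov–Smolensky approximation lemma for `GC⁰(k)[p]` circuits**
(Grewal–Kumar 2024, Thm. 3.8, PRODUCT FORM), extending the tree's `Smolensky.razborov_smolensky`
(`RazborovSmolenskyApprox.lean`: basis `accBasis p = {¬, ∧, ∨, MOD_p}`, degree `((p-1)ℓ)^d`) to
the basis `gcBasis k p = {¬, MOD_{p,m}, G(k) gates}` of `Complexity/BallGates.lean`: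

for every prime `p`, every circuit `C` over `gcBasis k p` on `n` inputs and every `ℓ ≥ 1` there
are a polynomial function `P : {0,1}ⁿ → 𝔽_p` of degree at most `((p-1)ℓ(k+1) + k)^{acDepth C}`
and an exceptional set `E` with `|E| · p^ℓ ≤ size(C) · 2ⁿ` such that `P(x) = [C(x)]` for all
`x ∉ E` (`razborov_smolensky_ball`; multi-output form `razborov_smolensky_ball_multi`). For
`k = 0` (`∧`, `∨` are `G(0)` gates) this is the classical lemma up to `+0`.

The development mirrors part I/II of the `accBasis` files step by step, with the gate polynomial
`polyOpB` dispatching NOT / `MOD_p` gates (symbolic codes `0` / `3`, exact formulas `1 - v`,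
`(Σ vₐ)^{p-1}`) and sending every other gate of the basis — necessarily a `G(k)` gate
(`mem_ballGates_of_mem_gcBasis`) — to the ball polynomial `ballPoly` of
`RazborovSmolenskyBall.lean` for a chosen centre / outside value (`ballCentre`, `ballOut`):

* `avalsB`, `apxB` — the polynomial semantics (fold in program order) and the approximant;
* `apxB_mem_lowDeg` — degree `≤ M^{acDepth C}`, `M = ballDegree p k ℓ = (p-1)ℓ(k+1) + k`
  (per level: Grewal–Kumar's composition argument; NOT gates free);
* `apxB_eq_bit_eval` — off the error events `GateErrB` the approximant is the circuit's value;
* `card_locErrB_mul_le` — per gate and input at most a `p^{-ℓ}` fraction of the local seeds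
  err (NOT/`MOD_p`: never; `G(k)`: `card_ballPoly_ne_mul_le`); `exists_good_seedB` — averaging
  over the global seed `Fin s → Fin ℓ → Fin (2^{maxFanIn}) → 𝔽_p`;
* `razborov_smolensky_ball`, `razborov_smolensky_ball_multi`, and `ballDegree_le`
  (`M ≤ ((p-1)ℓ + 1)(k+1)`) for the consumers' arithmetic.

Deliberately NOT here: the sharp additive degree `O((k + log(1/ε))(k + log(s/ε))^{d-1})` of the
printed Thm. 3.8 (needs the [STV] probabilistic polynomial for `THR^k`, Grewal–Kumar Lemma 3.5)
— TODO(sharp form); the relational / random-advice corollaries (see `SmolenskyRelations.lean`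
for the `accBasis` versions — the same four proofs apply verbatim with `razborov_smolensky_ball_multi`
and `acBasis_subset_gcBasis`).

## References

* S. Grewal, V. M. Kumar, *Improved circuit lower bounds and quantum-classical separations*,
  arXiv:2408.16406 (2024), §2.1, Lemma 3.6, Thm. 3.8 [GrewalKumar2024].
* R. Smolensky, *Algebraic methods in the theory of lower bounds for Boolean circuit
  complexity*, STOC 1987, Lemmas 1–2 [Smolensky1987].
-/

noncomputable section

namespace Literature.Computability.MetaComplexity

open Finset Literature.Computability.Complexity Literature.Computability.Complexity.GateList

namespace Smolensky

open scoped Classical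

variable {n : ℕ} {p : ℕ} [Fact p.Prime]

/-! ### The `G(k)` gates of a `gcBasis k p` circuit -/

/-- A gate whose gate function is a `G(k)` gate: the ball property of its truth table.
[cite: GrewalKumar2024, §2.1] -/
theorem Gate.ballSpec {k : ℕ} {g : Gate (Fin n)} (h : g.fn ∈ ballGates k) :
    ∃ c : Fin g.arity → Bool, ∃ b : Bool, ∀ v : Fin g.arity → Bool,
      k < (univ.filter fun i => v i ≠ c i).card → g.op v = b := h

/-- A chosen centre of a `G(k)` gate. [cite: GrewalKumar2024, §2.1] -/
def ballCentre {k : ℕ} {g : Gate (Fin n)} (h : g.fn ∈ ballGates k) : Fin g.arity → Bool :=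
  (Gate.ballSpec h).choose

/-- The outside value of a `G(k)` gate (for the chosen centre). [cite: GrewalKumar2024, §2.1] -/
def ballOut {k : ℕ} {g : Gate (Fin n)} (h : g.fn ∈ ballGates k) : Bool :=
  (Gate.ballSpec h).choose_spec.choose

/-- Outside the ball around the chosen centre the gate outputs `ballOut`.
[cite: GrewalKumar2024, §2.1] -/
theorem ballOut_spec {k : ℕ} {g : Gate (Fin n)} (h : g.fn ∈ ballGates k) (v : Fin g.arity → Bool)
    (hv : k < (univ.filter fun i => v i ≠ ballCentre h i).card) : g.op v = ballOut h :=
  (Gate.ballSpec h).choose_spec.choose_spec v hv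

omit [Fact p.Prime] in
/-- In the basis `gcBasis k p`, a gate function that is neither `¬` (code `0`) nor `MOD_p`
(code `3`) is a `G(k)` gate (a `MOD_{p,m}` of arity `≤ 1` that coincides with `∧ₘ`/`∨ₘ` is a
`G(0)` gate). [cite: GrewalKumar2024, §2.1] -/
theorem mem_ballGates_of_mem_gcBasis {k : ℕ} {f : GateFn} (hf : f ∈ gcBasis k p)
    (h0 : accCode p f ≠ 0) (h3 : accCode p f ≠ 3) : f ∈ ballGates k := by
  rcases mem_gcBasis_iff.1 hf with rfl | ⟨m, rfl⟩ | hb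
  · exact absurd (BT.accCode_not p) h0
  · have hle : accCode p (GateFn.modGate p m) ≤ 3 :=
      BT.accCode_le_three (Or.inr (Set.mem_iUnion.2 ⟨m, rfl⟩))
    by_cases h1 : accCode p (GateFn.modGate p m) = 1
    · rw [BT.fn_eq_and_of_accCode h1]; exact and_mem_ballGates _ _
    by_cases h2 : accCode p (GateFn.modGate p m) = 2
    · rw [BT.fn_eq_or_of_accCode h2]; exact or_mem_ballGates _ _
    omega
  · exact hb

/-! ### The polynomial semantics with `G(k)` gates -/

/-- **The gate polynomial over the basis `gcBasis k p`** with local trial coefficients `cf`: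
NOT and `MOD_p` gates (codes `0`, `3`) exactly as in `polyOpL` (`1 - v`, `(Σ vₐ)^{p-1}`), every
other `G(k)` gate by `ballPoly` for a chosen centre/outside value, and any foreign gate
(harmlessly) by the `MOD_p` formula. [cite: GrewalKumar2024, Thm. 3.8 (proof)] -/
def polyOpB (k ℓ : ℕ) (cf : ℕ → ℕ → ZMod p) (g : Gate (Fin n)) (v : Fin g.arity → ZMod p) :
    ZMod p :=
  if accCode p g.fn = 0 then 1 - ∑ a, v a
  else if accCode p g.fn = 3 then (∑ a, v a) ^ (p - 1)
  else if h : g.fn ∈ ballGates k then ballPoly k ℓ cf g.op (ballCentre h) (ballOut h) v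
  else (∑ a, v a) ^ (p - 1)

/-- On NOT and `MOD_p` gates the new semantics is Smolensky's. [cite: Smolensky1987, Lemma 1] -/
theorem polyOpB_eq_polyOpL (k ℓ : ℕ) (cf : ℕ → ℕ → ZMod p) (g : Gate (Fin n))
    (h : accCode p g.fn = 0 ∨ accCode p g.fn = 3) (v : Fin g.arity → ZMod p) :
    polyOpB k ℓ cf g v = polyOpL ℓ cf g v := by
  rcases h with h | h <;> simp [polyOpB, polyOpL, h]

/-- The gate polynomial read from a seed reader at gate index `j`.
[cite: GrewalKumar2024, Thm. 3.8 (proof)] -/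
def polyOpBR (k ℓ : ℕ) (ρ : Seed p) (j : ℕ) (g : Gate (Fin n)) (v : Fin g.arity → ZMod p) :
    ZMod p :=
  polyOpB k ℓ (ρ j) g v

/-- **The polynomial semantics of a gate list over `gcBasis k p`** (fold in program order, as
`avals`). [cite: GrewalKumar2024, Thm. 3.8 (proof)] -/
def avalsB (k ℓ : ℕ) (ρ : Seed p) (x : Fin n → Bool) (gs : List (Gate (Fin n))) :
    List (ZMod p) :=
  gs.foldl (fun vs g => vs ++ [polyOpBR k ℓ ρ vs.length g fun a => wireF x vs (g.args a)]) []

/-- **The approximating function** of a circuit for the seed reader `ρ`.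
[cite: GrewalKumar2024, Thm. 3.8 (proof)] -/
def apxB (k ℓ : ℕ) (ρ : Seed p) (C : Circuit (Fin n)) : CubeFn (ZMod p) n :=
  fun x => wireF x (avalsB k ℓ ρ x C.gates) C.output

/-! ### The fold: prefixes and the gate equations -/

section Fold

variable (k ℓ : ℕ) (ρ : Seed p) (x : Fin n → Bool)

/-- One more gate appends its polynomial value. [folklore] -/
private theorem avalsB_append_singleton (gs : List (Gate (Fin n))) (g : Gate (Fin n)) :
    avalsB k ℓ ρ x (gs ++ [g]) =
      avalsB k ℓ ρ x gs ++ [polyOpBR k ℓ ρ (avalsB k ℓ ρ x gs).length g fun a =>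
        wireF x (avalsB k ℓ ρ x gs) (g.args a)] := by
  simp [avalsB, List.foldl_append]

/-- `avalsB` has one entry per gate. [folklore] -/
@[simp] private theorem length_avalsB (gs : List (Gate (Fin n))) :
    (avalsB k ℓ ρ x gs).length = gs.length := by
  induction gs using List.reverseRecOn with
  | nil => rfl
  | append_singleton gs g ih => simp [avalsB_append_singleton, ih]

/-- The values of a prefix are a prefix of the values. [folklore] -/
private theorem avalsB_append (gs sfx : List (Gate (Fin n))) :
    ∃ t, avalsB k ℓ ρ x (gs ++ sfx) = avalsB k ℓ ρ x gs ++ t := by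
  induction sfx using List.reverseRecOn with
  | nil => exact ⟨[], by simp⟩
  | append_singleton sfx g ih =>
    obtain ⟨t, ht⟩ := ih
    refine ⟨t ++ [polyOpBR k ℓ ρ (avalsB k ℓ ρ x (gs ++ sfx)).length g fun a =>
      wireF x (avalsB k ℓ ρ x (gs ++ sfx)) (g.args a)], ?_⟩
    rw [← List.append_assoc, avalsB_append_singleton, ht, List.append_assoc]

/-- Entries of a prefix are unchanged by later gates. [folklore] -/
private theorem getD_avalsB_append (gs sfx : List (Gate (Fin n))) {m : ℕ} (hm : m < gs.length) :
    (avalsB k ℓ ρ x (gs ++ sfx)).getD m 0 = (avalsB k ℓ ρ x gs).getD m 0 := by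
  obtain ⟨t, ht⟩ := avalsB_append k ℓ ρ x gs sfx
  rw [ht, List.getD_eq_getElem?_getD, List.getD_eq_getElem?_getD,
    List.getElem?_append_left (by simpa using hm)]

/-- Wires into a prefix are unchanged by later gates. [folklore] -/
private theorem wireF_avalsB_append (gs sfx : List (Gate (Fin n))) (u : Fin n ⊕ ℕ)
    (hu : ∀ m, u = .inr m → m < gs.length) :
    wireF x (avalsB k ℓ ρ x (gs ++ sfx)) u = wireF x (avalsB k ℓ ρ x gs) u := by
  cases u with
  | inl i => rfl
  | inr m => exact getD_avalsB_append k ℓ ρ x gs sfx (hu m rfl)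

/-- **The polynomial gate equations**: entry `j` of `avalsB` is the polynomial of gate `j`
applied to the (polynomial) values of its argument wires. [cite: GrewalKumar2024, Thm. 3.8 (proof)] -/
theorem getD_avalsB_eq_polyOpB (C : Circuit (Fin n)) (j : ℕ) (hj : j < C.gates.length) :
    (avalsB k ℓ ρ x C.gates).getD j 0 =
      polyOpBR k ℓ ρ j C.gates[j] fun a => wireF x (avalsB k ℓ ρ x C.gates) (C.gates[j].args a) := by
  have hsplit : C.gates = C.gates.take j ++ [C.gates[j]] ++ C.gates.drop (j + 1) := by
    conv_lhs => rw [← List.take_append_drop (j + 1) C.gates]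
    rw [List.take_add_one, List.getElem?_eq_getElem hj]
    rfl
  have hlenj : (C.gates.take j).length = j := List.length_take_of_le hj.le
  have hget : (avalsB k ℓ ρ x C.gates).getD j 0 =
      polyOpBR k ℓ ρ j C.gates[j] fun a =>
        wireF x (avalsB k ℓ ρ x (C.gates.take j)) (C.gates[j].args a) := by
    obtain ⟨t, ht⟩ := avalsB_append k ℓ ρ x (C.gates.take j ++ [C.gates[j]]) (C.gates.drop (j + 1))
    rw [← hsplit] at ht
    rw [ht, avalsB_append_singleton, List.getD_eq_getElem?_getD, List.append_assoc,
      List.getElem?_append_right (by simp [hlenj]), length_avalsB, hlenj, Nat.sub_self]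
    simp
  have key : ∀ u : Fin n ⊕ ℕ, (∀ m, u = .inr m → m < j) →
      wireF x (avalsB k ℓ ρ x C.gates) u = wireF x (avalsB k ℓ ρ x (C.gates.take j)) u := by
    intro u hu
    have h := wireF_avalsB_append k ℓ ρ x (C.gates.take j) (C.gates.drop j) u
      (by rw [hlenj]; exact hu)
    rwa [List.take_append_drop] at h
  rw [hget]
  congr 1
  funext a
  exact (key _ fun m hm => C.wf j hj a m hm).symm

end Fold

/-! ### Degree -/

section Degree

variable (k ℓ : ℕ)

omit [Fact p.Prime] in
/-- `p - 1 ≤ (p-1)ℓ(k+1) + k` for `ℓ ≥ 1`. [folklore] -/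
private theorem sub_one_le_ballDegree (hℓ : 1 ≤ ℓ) : p - 1 ≤ ballDegree p k ℓ := by
  unfold ballDegree
  calc p - 1 = (p - 1) * 1 * 1 := by ring
    _ ≤ (p - 1) * ℓ * (k + 1) :=
        Nat.mul_le_mul (Nat.mul_le_mul_left _ hℓ) (Nat.le_add_left 1 k)
    _ ≤ (p - 1) * ℓ * (k + 1) + k := Nat.le_add_right _ _

/-- **Degree of one gate polynomial** (Grewal–Kumar 2024, Thm. 3.8, induction step; product
form): if every argument function has degree `≤ M^S`, `M = (p-1)ℓ(k+1) + k`, `ℓ ≥ 1`, then the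
gate's polynomial, as a function of the input, has degree `≤ M^{w + S}` where `w = acWeight g.fn`
(`0` for NOT, else `1`). [cite: GrewalKumar2024, Thm. 3.8 (proof)] -/
theorem polyOpB_fn_mem_lowDeg (hℓ : 1 ≤ ℓ) (cf : ℕ → ℕ → ZMod p) (g : Gate (Fin n)) {S : ℕ}
    (W : Fin g.arity → CubeFn (ZMod p) n)
    (hW : ∀ a, W a ∈ lowDeg (ZMod p) n (ballDegree p k ℓ ^ S)) :
    (fun x => polyOpB k ℓ cf g fun a => W a x) ∈
      lowDeg (ZMod p) n (ballDegree p k ℓ ^ (acWeight g.fn + S)) := by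
  have hp : 2 ≤ p := (Fact.out : p.Prime).two_le
  set M : ℕ := ballDegree p k ℓ with hM
  have hpM : p - 1 ≤ M := sub_one_le_ballDegree k ℓ hℓ
  have hsum : (∑ a, W a) ∈ lowDeg (ZMod p) n (M ^ S) := Submodule.sum_mem _ fun a _ => hW a
  -- the `MOD_p` formula `(Σ v)^{p-1}` has degree `≤ (p-1) M^S ≤ M^{1+S}`
  have hpow : (∑ a, W a) ^ (p - 1) ∈ lowDeg (ZMod p) n (M ^ (1 + S)) := by
    refine lowDeg_mono ?_ (pow_mem_lowDeg hsum (p - 1))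
    calc (p - 1) * M ^ S ≤ M * M ^ S := Nat.mul_le_mul_right _ hpM
      _ = M ^ (1 + S) := by rw [pow_add, pow_one]
  by_cases h0 : accCode p g.fn = 0
  · -- NOT: `1 - Σ v`, weight `0`
    have hfn : g.fn = GateFn.not := BT.fn_eq_not_of_accCode h0
    have e : (fun x => polyOpB k ℓ cf g fun a => W a x) = 1 - ∑ a, W a := by
      funext x
      simp [polyOpB, h0, Finset.sum_apply]
    rw [e, hfn, acWeight_not, zero_add]
    exact Submodule.sub_mem _ (one_mem_lowDeg _) hsum
  have hw : acWeight g.fn = 1 := BT.acWeight_eq_one_of_accCode_ne h0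
  rw [hw]
  by_cases h3 : accCode p g.fn = 3
  · have e : (fun x => polyOpB k ℓ cf g fun a => W a x) = (∑ a, W a) ^ (p - 1) := by
      funext x
      simp [polyOpB, h3, Finset.sum_apply]
    rw [e]
    exact hpow
  by_cases hb : g.fn ∈ ballGates k
  · -- a `G(k)` gate: the ball polynomial
    have e : (fun x => polyOpB k ℓ cf g fun a => W a x) =
        fun x => ballPoly k ℓ cf g.op (ballCentre hb) (ballOut hb) fun a => W a x := by
      funext x
      simp [polyOpB, h0, h3, hb]
    rw [e, pow_add, pow_one]
    exact ballPoly_fn_mem_lowDeg k ℓ cf g.op (ballCentre hb) (ballOut hb) W hW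
  · have e : (fun x => polyOpB k ℓ cf g fun a => W a x) = (∑ a, W a) ^ (p - 1) := by
      funext x
      simp [polyOpB, h0, h3, hb, Finset.sum_apply]
    rw [e]
    exact hpow

/-- **Degree of the polynomial semantics**: for `ℓ ≥ 1`, the value of gate `j` of the prefix of
length `K`, as a function of the input, has degree at most `M^{depth of gate j}`,
`M = (p-1)ℓ(k+1) + k` (`acWeight`-depth: negations free). [cite: GrewalKumar2024, Thm. 3.8 (proof)] -/
theorem avalsB_mem_lowDeg (hℓ : 1 ≤ ℓ) (ρ : Seed p) (C : Circuit (Fin n)) :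
    ∀ K, K ≤ C.gates.length → ∀ j, j < K →
      (fun x => (avalsB k ℓ ρ x (C.gates.take K)).getD j 0) ∈
        lowDeg (ZMod p) n (ballDegree p k ℓ ^ ((wdepths acWeight (C.gates.take K)).getD j 0)) := by
  have hp : 2 ≤ p := (Fact.out : p.Prime).two_le
  have hM1 : 1 ≤ ballDegree p k ℓ := le_trans (by omega) (sub_one_le_ballDegree k ℓ hℓ)
  intro K
  induction K with
  | zero => intro _ j hj; exact absurd hj (Nat.not_lt_zero j)
  | succ K ih =>
    intro hK j hj
    have hK' : K < C.gates.length := hK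
    have htake : C.gates.take (K + 1) = C.gates.take K ++ [C.gates[K]] := by
      rw [List.take_add_one, List.getElem?_eq_getElem hK']
      rfl
    have hlenK : (C.gates.take K).length = K := List.length_take_of_le hK'.le
    rw [htake]
    rcases Nat.lt_succ_iff_lt_or_eq.1 hj with hjK | rfl
    · -- an old gate
      have e1 : (fun x => (avalsB k ℓ ρ x (C.gates.take K ++ [C.gates[K]])).getD j 0) =
          fun x => (avalsB k ℓ ρ x (C.gates.take K)).getD j 0 := by
        funext x
        exact getD_avalsB_append k ℓ ρ x _ _ (by rw [hlenK]; exact hjK)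
      have e2 : (wdepths acWeight (C.gates.take K ++ [C.gates[K]])).getD j 0 =
          (wdepths acWeight (C.gates.take K)).getD j 0 := by
        rw [wdepths_append_singleton, List.getD_eq_getElem?_getD, List.getD_eq_getElem?_getD,
          List.getElem?_append_left (by rw [length_wdepths, hlenK]; exact hjK)]
      rw [e1, e2]
      exact ih hK'.le j hjK
    · -- the new gate `g = C.gates[K]` at position `j = K`
      set g := C.gates[j] with hg
      have e1 : (fun x => (avalsB k ℓ ρ x (C.gates.take j ++ [g])).getD j 0) =
          fun x => polyOpB k ℓ (ρ j) g fun a => wireF x (avalsB k ℓ ρ x (C.gates.take j)) (g.args a) := by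
        funext x
        rw [avalsB_append_singleton, List.getD_eq_getElem?_getD,
          List.getElem?_append_right (by rw [length_avalsB, hlenK]), length_avalsB, hlenK,
          Nat.sub_self]
        simp [polyOpBR]
      have e2 : (wdepths acWeight (C.gates.take j ++ [g])).getD j 0 =
          acWeight g.fn + univ.sup fun a => wireDepthOf (wdepths acWeight (C.gates.take j)) (g.args a) := by
        have h := getD_wdepths_append_singleton acWeight (C.gates.take j) g
        rwa [hlenK] at h
      rw [e1, e2]
      refine polyOpB_fn_mem_lowDeg k ℓ hℓ (ρ j) g
        (fun a => fun x => wireF x (avalsB k ℓ ρ x (C.gates.take j)) (g.args a)) fun a => ?_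
      have hle : wireDepthOf (wdepths acWeight (C.gates.take j)) (g.args a) ≤
          univ.sup fun a => wireDepthOf (wdepths acWeight (C.gates.take j)) (g.args a) :=
        Finset.le_sup (f := fun a => wireDepthOf (wdepths acWeight (C.gates.take j)) (g.args a))
          (Finset.mem_univ a)
      refine lowDeg_mono (Nat.pow_le_pow_right hM1 hle) ?_
      cases hga : g.args a with
      | inl i =>
        simp only [wireF, wireDepthOf_inl, pow_zero]
        exact bitFn_mem_lowDeg i le_rfl
      | inr m =>
        have hm : m < j := C.wf j hK' a m hga
        simp only [wireF, wireDepthOf_inr]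
        exact ih hK'.le m hm

/-- **The approximating function has degree `≤ ((p-1)ℓ(k+1)+k)^{acDepth C}`** (for `ℓ ≥ 1`).
[cite: GrewalKumar2024, Thm. 3.8] -/
theorem apxB_mem_lowDeg (hℓ : 1 ≤ ℓ) (ρ : Seed p) (C : Circuit (Fin n)) :
    apxB k ℓ ρ C ∈ lowDeg (ZMod p) n (ballDegree p k ℓ ^ C.acDepth) := by
  have hp : 2 ≤ p := (Fact.out : p.Prime).two_le
  have hM1 : 1 ≤ ballDegree p k ℓ := le_trans (by omega) (sub_one_le_ballDegree k ℓ hℓ)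
  unfold apxB
  cases ho : C.output with
  | inl i =>
    simp only [wireF]
    exact bitFn_mem_lowDeg i (Nat.one_le_pow _ _ hM1)
  | inr m =>
    have hm : m < C.gates.length := C.wf_output m ho
    have h := avalsB_mem_lowDeg k ℓ hℓ ρ C C.gates.length le_rfl m hm
    rw [List.take_length] at h
    have hd : C.acDepth = (wdepths acWeight C.gates).getD m 0 := by
      rw [Circuit.acDepth, circuit_depthWith, ho, wireDepthOf_inr]
    simp only [wireF]
    rwa [hd]

end Degree

/-! ### Exactness off the error set -/

section Exact

variable (k ℓ : ℕ)

/-- **The local error event**: the polynomial of gate `g`, applied to the TRUE values `v` of its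
arguments, differs from the true value of the gate. [cite: GrewalKumar2024, Thm. 3.8 (proof)] -/
def LocErrB (cf : ℕ → ℕ → ZMod p) (g : Gate (Fin n)) (v : Fin g.arity → Bool) : Prop :=
  polyOpB k ℓ cf g (fun a => bit p (v a)) ≠ bit p (g.op v)

/-- **The error event of gate `j` at input `x`** under the seed reader `ρ`.
[cite: GrewalKumar2024, Thm. 3.8 (proof)] -/
def GateErrB (ρ : Seed p) (C : Circuit (Fin n)) (x : Fin n → Bool) (j : ℕ) : Prop :=
  ∃ hj : j < C.gates.length, LocErrB k ℓ (ρ j) C.gates[j] (trueArgs C x j hj)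

/-- **No gate errs ⇒ the polynomial semantics is the Boolean one**: every entry of `avalsB` is
the bit of the corresponding entry of the true transcript. [cite: GrewalKumar2024, Thm. 3.8 (proof)] -/
theorem getD_avalsB_eq_bit (ρ : Seed p) (C : Circuit (Fin n)) (x : Fin n → Bool)
    (h : ∀ j, j < C.gates.length → ¬ GateErrB k ℓ ρ C x j) :
    ∀ j, j < C.gates.length →
      (avalsB k ℓ ρ x C.gates).getD j 0 = bit p ((transcript x [] C.gates).getD j false) := by
  intro j
  induction j using Nat.strong_induction_on with
  | _ j ih =>
    intro hj
    rw [getD_avalsB_eq_polyOpB k ℓ ρ x C j hj, getD_transcript_eq_gateValue C x j hj]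
    have hargs : (fun a => wireF x (avalsB k ℓ ρ x C.gates) (C.gates[j].args a)) =
        fun a => bit p (trueArgs C x j hj a) := by
      funext a
      unfold trueArgs
      cases hga : C.gates[j].args a with
      | inl i => rfl
      | inr m =>
        have hm : m < j := C.wf j hj a m hga
        simp only [wireF, wireVal]
        exact ih m hm (hm.trans hj)
    have hne := h j hj
    simp only [GateErrB, LocErrB, hj, exists_true_left, ne_eq, not_not] at hne
    rw [polyOpBR, hargs, hne]
    rfl

/-- **Off the error set the approximating function is the circuit's value.**
[cite: GrewalKumar2024, Thm. 3.8 (proof)] -/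
theorem apxB_eq_bit_eval (ρ : Seed p) (C : Circuit (Fin n)) (x : Fin n → Bool)
    (h : ∀ j, j < C.gates.length → ¬ GateErrB k ℓ ρ C x j) :
    apxB k ℓ ρ C x = bit p (C.eval x) := by
  rw [apxB, eval_eq_wireVal]
  cases ho : C.output with
  | inl i => rfl
  | inr m =>
    simp only [wireF, wireVal]
    exact getD_avalsB_eq_bit k ℓ ρ C x h m (C.wf_output m ho)

end Exact

/-! ### Counting the errors of one gate -/

/-- **At most a `p^{-ℓ}` fraction of the local seeds err at a gate of `gcBasis k p`**: NOT and
`MOD_p` gates never err (`not_locErr_of_accCode_zero/three`), `G(k)` gates err on at most a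
`p^{-ℓ}` fraction (`card_ballPoly_ne_mul_le`); positions are addressed in `Fin A`, `A ≥ 2^{arity}`.
[cite: Smolensky1987, Lemma 1] -/
theorem card_locErrB_mul_le (k ℓ A : ℕ) (g : Gate (Fin n)) (hg : g.fn ∈ gcBasis k p)
    (hA : 2 ^ g.arity ≤ A) (v : Fin g.arity → Bool) :
    (univ.filter fun cf : Fin ℓ → Fin A → ZMod p => LocErrB k ℓ (lreader cf) g v).card * p ^ ℓ ≤
      Fintype.card (Fin ℓ → Fin A → ZMod p) := by
  classical
  -- no error at all for NOT / MOD gates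
  have triv : (∀ cf : Fin ℓ → Fin A → ZMod p, ¬ LocErrB k ℓ (lreader cf) g v) →
      (univ.filter fun cf : Fin ℓ → Fin A → ZMod p => LocErrB k ℓ (lreader cf) g v).card * p ^ ℓ ≤
        Fintype.card (Fin ℓ → Fin A → ZMod p) := by
    intro h
    rw [Finset.filter_eq_empty_iff.2 fun cf _ => h cf, Finset.card_empty, zero_mul]
    exact Nat.zero_le _
  have hexact : ∀ cf : Fin ℓ → Fin A → ZMod p, accCode p g.fn = 0 ∨ accCode p g.fn = 3 →
      (LocErrB k ℓ (lreader cf) g v ↔ LocErr ℓ (lreader cf) g v) := fun cf h => by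
    simp only [LocErrB, LocErr, polyOpB_eq_polyOpL k ℓ _ g h]
  by_cases h0 : accCode p g.fn = 0
  · exact triv fun cf hE =>
      not_locErr_of_accCode_zero ℓ (lreader cf) g h0 v ((hexact cf (Or.inl h0)).1 hE)
  by_cases h3 : accCode p g.fn = 3
  · exact triv fun cf hE =>
      not_locErr_of_accCode_three ℓ (lreader cf) g h3 v ((hexact cf (Or.inr h3)).1 hE)
  -- a `G(k)` gate
  have hb : g.fn ∈ ballGates k := mem_ballGates_of_mem_gcBasis hg h0 h3
  have hiff : ∀ cf : Fin ℓ → Fin A → ZMod p, LocErrB k ℓ (lreader cf) g v ↔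
      ballPoly k ℓ (lreader cf) g.op (ballCentre hb) (ballOut hb) (fun a => bit p (v a)) ≠
        bit p (g.op v) := fun cf => by
    simp only [LocErrB, polyOpB, h0, h3, hb, ↓reduceIte, ↓reduceDIte]
  rw [Finset.filter_congr fun cf _ => hiff cf]
  exact card_ballPoly_ne_mul_le k ℓ A g.op (ballCentre hb) (ballOut hb) (ballOut_spec hb) hA v

/-! ### The global seed and the approximation lemma -/

/-- **Some seed errs on few inputs** (union bound over the `s` gates and averaging over the
seed, as in Smolensky 1987, Lemma 2 / Grewal–Kumar 2024, proof of Thm. 3.8): for a circuit over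
`gcBasis k p` there is a global seed for which the inputs at which some gate polynomial errs number
at most `s · 2ⁿ / p^ℓ`. [cite: GrewalKumar2024, Thm. 3.8 (proof)] -/
theorem exists_good_seedB (k : ℕ) (C : Circuit (Fin n)) (hC : C.IsOver (gcBasis k p)) (ℓ : ℕ) :
    ∃ ω : Fin C.gates.length → Fin ℓ → Fin (2 ^ C.maxFanIn) → ZMod p,
      (univ.filter fun x : Fin n → Bool =>
          ∃ j, j < C.gates.length ∧ GateErrB k ℓ (reader ω) C x j).card * p ^ ℓ ≤
        C.gates.length * 2 ^ n := by
  classical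
  set s := C.gates.length with hs
  set L : Type := Fin ℓ → Fin (2 ^ C.maxFanIn) → ZMod p with hL
  -- per gate and input: few global seeds err
  have hloc : ∀ (j : Fin s) (x : Fin n → Bool),
      (univ.filter fun ω : Fin s → L => GateErrB k ℓ (reader ω) C x j).card * p ^ ℓ ≤
        Fintype.card (Fin s → L) := by
    intro j x
    have hj : (j : ℕ) < C.gates.length := j.isLt
    have hiff : ∀ ω : Fin s → L, GateErrB k ℓ (reader ω) C x j ↔
        LocErrB k ℓ (lreader (ω j)) C.gates[(j : ℕ)] (trueArgs C x j hj) := by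
      intro ω
      rw [← reader_apply ω j]
      exact ⟨fun ⟨_, h⟩ => h, fun h => ⟨hj, h⟩⟩
    have hA : 2 ^ C.gates[(j : ℕ)].arity ≤ 2 ^ C.maxFanIn :=
      Nat.pow_le_pow_right Nat.two_pos (BT.arity_le_maxFanIn C (List.getElem_mem hj))
    have hP := card_locErrB_mul_le k ℓ (2 ^ C.maxFanIn) C.gates[(j : ℕ)]
      (hC _ (List.getElem_mem hj)) hA (trueArgs C x j hj)
    have hcoord := card_filter_apply_mul j
      (fun c : L => LocErrB k ℓ (lreader c) C.gates[(j : ℕ)] (trueArgs C x j hj))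
    rw [Finset.filter_congr fun ω _ => hiff ω]
    have hLpos : 0 < Fintype.card L := Fintype.card_pos
    refine Nat.le_of_mul_le_mul_left ?_ hLpos
    calc Fintype.card L * ((univ.filter fun ω : Fin s → L =>
            LocErrB k ℓ (lreader (ω j)) C.gates[(j : ℕ)] (trueArgs C x j hj)).card * p ^ ℓ)
        = (univ.filter fun c : L =>
            LocErrB k ℓ (lreader c) C.gates[(j : ℕ)] (trueArgs C x j hj)).card * p ^ ℓ *
            Fintype.card (Fin s → L) := by
          rw [← mul_assoc, mul_comm (Fintype.card L), hcoord]
          ring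
      _ ≤ Fintype.card L * Fintype.card (Fin s → L) := Nat.mul_le_mul_right _ hP
  -- averaging
  by_contra hall
  push Not at hall
  have hsum : ∀ ω : Fin s → L,
      (univ.filter fun x : Fin n → Bool => ∃ j, j < s ∧ GateErrB k ℓ (reader ω) C x j).card ≤
        ∑ j : Fin s, (univ.filter fun x : Fin n → Bool => GateErrB k ℓ (reader ω) C x j).card := by
    intro ω
    refine (Finset.card_le_card ?_).trans Finset.card_biUnion_le
    intro x hx
    simp only [Finset.mem_filter, Finset.mem_univ, true_and] at hx
    obtain ⟨j, hj, hE⟩ := hx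
    exact Finset.mem_biUnion.2 ⟨⟨j, hj⟩, Finset.mem_univ _, by simpa using hE⟩
  have htotal : ∑ ω : Fin s → L, (univ.filter fun x : Fin n → Bool =>
      ∃ j, j < s ∧ GateErrB k ℓ (reader ω) C x j).card * p ^ ℓ ≤
        s * 2 ^ n * Fintype.card (Fin s → L) := by
    calc ∑ ω : Fin s → L, (univ.filter fun x : Fin n → Bool =>
          ∃ j, j < s ∧ GateErrB k ℓ (reader ω) C x j).card * p ^ ℓ
        ≤ ∑ ω : Fin s → L, (∑ j : Fin s,
            (univ.filter fun x : Fin n → Bool => GateErrB k ℓ (reader ω) C x j).card) * p ^ ℓ :=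
          Finset.sum_le_sum fun ω _ => Nat.mul_le_mul_right _ (hsum ω)
      _ = ∑ j : Fin s, ∑ x : Fin n → Bool,
            (univ.filter fun ω : Fin s → L => GateErrB k ℓ (reader ω) C x j).card * p ^ ℓ := by
          simp only [Finset.card_filter, Finset.sum_mul]
          rw [Finset.sum_comm]
          refine Finset.sum_congr rfl fun j _ => ?_
          rw [Finset.sum_comm]
      _ ≤ ∑ _j : Fin s, ∑ _x : Fin n → Bool, Fintype.card (Fin s → L) :=
          Finset.sum_le_sum fun j _ => Finset.sum_le_sum fun x _ => hloc j x
      _ = s * 2 ^ n * Fintype.card (Fin s → L) := by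
          simp only [Finset.sum_const, smul_eq_mul, Finset.card_univ, Fintype.card_fun,
            Fintype.card_bool, Fintype.card_fin]
          ring
  have hlower : ∑ ω : Fin s → L, (s * 2 ^ n + 1) ≤ ∑ ω : Fin s → L,
      (univ.filter fun x : Fin n → Bool => ∃ j, j < s ∧ GateErrB k ℓ (reader ω) C x j).card * p ^ ℓ :=
    Finset.sum_le_sum fun ω _ => hall ω
  rw [Finset.sum_const, smul_eq_mul, Finset.card_univ] at hlower
  have hpos : 0 < Fintype.card (Fin s → L) := Fintype.card_pos
  nlinarith [hlower.trans htotal]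

/-- **The Razborov–Smolensky approximation lemma for `GC⁰(k)[p]` circuits** (Grewal–Kumar 2024,
Thm. 3.8, in product form). For a prime `p`, a circuit `C` over
`gcBasis k p = {¬, MOD_{p,m}, G(k) gates}` on `n` inputs, and `ℓ ≥ 1`, there are a function
`P : {0,1}ⁿ → 𝔽_p` of degree at most `((p-1)ℓ(k+1) + k)^{acDepth C}` (`P ∈ lowDeg`) and an
exceptional set `E` of inputs with `|E| · p^ℓ ≤ size(C) · 2ⁿ`, such that `P(x) = [C(x)] ∈ {0,1}`
for every `x ∉ E`. (Printed: degree `O((k + log(1/ε))(k + log(s/ε))^{d-1})` off an `ε`-fraction,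
via the sharper `THR^k` polynomial of [STV]; here Razborov's OR-polynomial over the
`(k+1)`-subsets is used, giving the product bound; `k = 0` recovers `razborov_smolensky`.)
[cite: GrewalKumar2024, Thm. 3.8] -/
theorem razborov_smolensky_ball (k : ℕ) (C : Circuit (Fin n)) (hC : C.IsOver (gcBasis k p))
    {ℓ : ℕ} (hℓ : 1 ≤ ℓ) :
    ∃ (P : CubeFn (ZMod p) n) (E : Finset (Fin n → Bool)),
      P ∈ lowDeg (ZMod p) n (ballDegree p k ℓ ^ C.acDepth) ∧ E.card * p ^ ℓ ≤ C.size * 2 ^ n ∧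
        ∀ x, x ∉ E → P x = bit p (C.eval x) := by
  classical
  obtain ⟨ω, hω⟩ := exists_good_seedB k C hC ℓ
  refine ⟨apxB k ℓ (reader ω) C,
    univ.filter fun x : Fin n → Bool => ∃ j, j < C.gates.length ∧ GateErrB k ℓ (reader ω) C x j,
    apxB_mem_lowDeg k ℓ hℓ _ C, hω, fun x hx => ?_⟩
  refine apxB_eq_bit_eval k ℓ _ C x fun j hj hE => hx ?_
  simp only [Finset.mem_filter, Finset.mem_univ, true_and]
  exact ⟨j, hj, hE⟩

/-- **Multi-output form.** Circuits `C_1, …, C_m` over `gcBasis k p` on the same `n` inputs,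
each of `acDepth ≤ d`, `ℓ ≥ 1`: polynomial functions `P_j` of degree `≤ ((p-1)ℓ(k+1)+k)^d` and
ONE exceptional set `E` with `|E|·p^ℓ ≤ (Σ_j size C_j)·2ⁿ` such that `P_j(x) = [C_j(x)]` for all
`j` and all `x ∉ E` (union of the exceptional sets; the form used for relation problems,
Grewal–Kumar 2024 §5). [cite: GrewalKumar2024, Thm. 3.8] -/
theorem razborov_smolensky_ball_multi (k : ℕ) {m : ℕ} (C : Fin m → Circuit (Fin n))
    (hC : ∀ j, (C j).IsOver (gcBasis k p)) {d : ℕ} (hd : ∀ j, (C j).acDepth ≤ d) {ℓ : ℕ}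
    (hℓ : 1 ≤ ℓ) :
    ∃ (P : Fin m → CubeFn (ZMod p) n) (E : Finset (Fin n → Bool)),
      (∀ j, P j ∈ lowDeg (ZMod p) n (ballDegree p k ℓ ^ d)) ∧
        E.card * p ^ ℓ ≤ (∑ j, (C j).size) * 2 ^ n ∧
        ∀ x, x ∉ E → ∀ j, P j x = bit p ((C j).eval x) := by
  classical
  have hp := (Fact.out : p.Prime)
  have hM1 : 1 ≤ ballDegree p k ℓ := le_trans (by have := hp.two_le; omega) (sub_one_le_ballDegree k ℓ hℓ)
  have hone : ∀ j, ∃ (P : CubeFn (ZMod p) n) (E : Finset (Fin n → Bool)),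
      P ∈ lowDeg (ZMod p) n (ballDegree p k ℓ ^ d) ∧ E.card * p ^ ℓ ≤ (C j).size * 2 ^ n ∧
        ∀ x, x ∉ E → P x = bit p ((C j).eval x) := fun j => by
    obtain ⟨P, E, hP, hE, hPE⟩ := razborov_smolensky_ball k (C j) (hC j) hℓ
    exact ⟨P, E, lowDeg_mono (Nat.pow_le_pow_right hM1 (hd j)) hP, hE, hPE⟩
  choose P E hP hE hPE using hone
  refine ⟨P, univ.biUnion E, hP, ?_, fun x hx j =>
    hPE j x fun h => hx (Finset.mem_biUnion.2 ⟨j, Finset.mem_univ _, h⟩)⟩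
  calc (univ.biUnion E).card * p ^ ℓ ≤ (∑ j, (E j).card) * p ^ ℓ :=
        Nat.mul_le_mul_right _ Finset.card_biUnion_le
    _ = ∑ j, (E j).card * p ^ ℓ := Finset.sum_mul _ _ _
    _ ≤ ∑ j, (C j).size * 2 ^ n := Finset.sum_le_sum fun j _ => hE j
    _ = (∑ j, (C j).size) * 2 ^ n := (Finset.sum_mul _ _ _).symm

/-- Degree bookkeeping for consumers: `(p-1)ℓ(k+1) + k ≤ ((p-1)ℓ + 1)·(k+1)` (so the degree of a
depth-`d` circuit is at most `(((p-1)ℓ + 1)(k+1))^d`, the product form of Grewal–Kumar's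
`O((k + log(s/ε))^d)`). [cite: GrewalKumar2024, Lemma 3.6] -/
theorem ballDegree_le (p k ℓ : ℕ) : ballDegree p k ℓ ≤ ((p - 1) * ℓ + 1) * (k + 1) := by
  unfold ballDegree; nlinarith

end Smolensky

end Literature.Computability.MetaComplexity
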